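import Mathlib
import Literature.Combinatorics.Optimization.SheraliAdamsLocalDistributions
import Literature.Combinatorics.Optimization.SheraliAdamsLocalDistributionsAlphabet
import HarnessLib

/-!
# The two Sherali–Adams currencies of the tree agree on `{0,1}ⁿ`: Kothari–Meka–Raghavendra's degree-`d`
# pseudoexpectations (functionals) ↔ Lee–Raghavendra–Steurer's `d`-local pseudo-densities — PROVED

[topic Combinatorics/Optimization]

The tree carries Sherali–Adams solutions in two printed currencies:

* [KothariMekaRaghavendra2017] Def. 3.3 (p. 9): "A degree `d` Sherali–Adams pseudoexpectation `Ẽ` is a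
  linear operator … such that: for every non-negative `p` that depends on only `d` variables, `Ẽ[p] ≥ 0`,
  and `Ẽ[1] = 1`" — `SAPseudoexpectation n d` (`LPRelaxationsMaxCSP.lean`), consumed by the binary facts
  `Schoenebeck2008_*`, `CharikarMakarychevMakarychev2009_maxCutSA`, `KothariMekaRaghavendra2017_thm14`, and
  produced from consistent local distributions by `LocalExpectations.toSA` (CMM Lemma 2.1,
  `SheraliAdamsLocalDistributions.lean`);
* [LeeRaghavendraSteurer2015] §7.1 (arXiv p. 27): "A function `D : Xⁿ → ℝ` is called a `d`-local
  pseudo-density (with respect to the measure `μ`) if `E_μ D = 1` and furthermore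
  `E_{x∼μ} D(x) g(x) ≥ 0` for all nonnegative `d`-juntas `g`" — `IsLocalPseudoDensity μ d D`
  (`NonnegativeRankJuntaDegree.lean`), consumed by LRS Thm 7.2/7.6, `CharikarMakarychevMakarychev2009_uniqueGamesSA`
  and its reductions (`UniqueGamesFromTwoLin.lean`, `RandomUniqueGamesSoundness.lean`, alphabet `{0,1}` per
  coordinate).

Lee–Raghavendra–Steurer (Thm 7.6, p. 29): "there is an equivalence between such lower bounds and the
existence of a `d`-local pseudo-density; we refer to [ChanLRS13] for a discussion"; Chan–Lee–Raghavendra–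
Steurer §2.1 (arXiv v3 p. 8): "using self-duality of `L²({−1,1}ⁿ)`, we may also think of `Ẽ ∈ L²`".  This
file PROVES the equivalence on `{0,1}ⁿ` with the uniform measure, so that results stated in one currency
feed hypotheses stated in the other:

* `SAPseudoexpectation.density` (`D(x) = 2ⁿ Ẽ(𝟙_x)`), `SAPseudoexpectation.muExpect_density_mul`
  (`E_x[D g] = Ẽ g`), `SAPseudoexpectation.isLocalPseudoDensity_density`;
* `SAPseudoexpectation.ofDensity` (a `d`-local pseudo-density IS a degree-`d` pseudoexpectation,
  `Ẽ g = E_x[D g]`), `SAPseudoexpectation.ofDensity_E`;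
* `LocalExpectations.toOn` — the binary consistent families of `SheraliAdamsLocalDistributions.lean` are the
  `X = Bool` case of the general-alphabet families `LocalExpectationsOn` of
  `SheraliAdamsLocalDistributionsAlphabet.lean` (same fields).

0 named facts; no `sorry`.

## References

* [KothariMekaRaghavendra2017] Def. 3.3 (p. 9).  [LeeRaghavendraSteurer2015] §7.1 (p. 27), Thm 7.6 (p. 29).
  [ChanEtAl2016] §2.1 (arXiv v3 p. 8).  [CharikarMakarychevMakarychev2009] Lemma 2.1 (p. 4–5).
-/

noncomputable section

open Finset

namespace Literature.Combinatorics.Optimization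

variable {n d : ℕ}

namespace SAPseudoexpectation

/-- **The pseudo-density of a degree-`d` pseudoexpectation**: `D(x) = 2ⁿ · Ẽ(𝟙_{x})` (Riesz representer
w.r.t. the uniform measure on `{0,1}ⁿ`). [cite: ChanEtAl2016, §2.1 (arXiv v3 p. 8: "we may also think of Ẽ ∈ L²")]
[cite: LeeRaghavendraSteurer2015, §7.1 (arXiv p. 27)] -/
def density (pE : SAPseudoexpectation n d) : (Fin n → Bool) → ℝ :=
  fun x => 2 ^ n * pE.E (fun y => if y = x then 1 else 0)

/-- **`E_x[D(x) g(x)] = Ẽ g`** (uniform measure on `{0,1}ⁿ`). [cite: ChanEtAl2016, §2.1 (arXiv v3 p. 8)] -/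
theorem muExpect_density_mul (pE : SAPseudoexpectation n d) (g : (Fin n → Bool) → ℝ) :
    muExpect (uniformWeight (Fin n) Bool) (fun x => pE.density x * g x) = pE.E g := by
  have hg : g = ∑ x : Fin n → Bool, g x • (fun y => if y = x then (1 : ℝ) else 0) := by
    funext y
    rw [Finset.sum_apply]
    simp only [Pi.smul_apply, smul_eq_mul, mul_ite, mul_one, mul_zero]
    rw [Finset.sum_ite_eq]
    simp
  conv_rhs => rw [hg, map_sum]
  simp only [map_smul, smul_eq_mul, muExpect, density, uniformWeight_fin_bool]
  refine sum_congr rfl fun x _ => ?_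
  have h2 : (2 : ℝ) ^ n ≠ 0 := by positivity
  field_simp

/-- **A degree-`d` pseudoexpectation gives a `d`-local pseudo-density** (uniform measure).
[cite: LeeRaghavendraSteurer2015, §7.1 (arXiv p. 27) and Thm 7.6 (p. 29: "equivalence between such lower bounds and the existence of a d-local pseudo-density")]
[cite: KothariMekaRaghavendra2017, Def. 3.3 (p. 9)] -/
theorem isLocalPseudoDensity_density (pE : SAPseudoexpectation n d) :
    IsLocalPseudoDensity (uniformWeight (Fin n) Bool) d pE.density := by
  refine ⟨?_, fun g hg hg0 => ?_⟩
  · have h := pE.muExpect_density_mul (fun _ => (1 : ℝ))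
    simp only [mul_one] at h
    rw [show (fun x => pE.density x) = pE.density from rfl] at h
    rw [h]
    exact pE.map_one
  · rw [pE.muExpect_density_mul g]
    exact pE.nonneg g ((isKJunta_iff_isJunta g).1 hg) hg0

/-- **A `d`-local pseudo-density (uniform measure on `{0,1}ⁿ`) IS a degree-`d` pseudoexpectation**:
`Ẽ g = E_x[D(x) g(x)]`. [cite: KothariMekaRaghavendra2017, Def. 3.3 (p. 9)]
[cite: LeeRaghavendraSteurer2015, §7.1 (arXiv p. 27)] -/
def ofDensity (D : (Fin n → Bool) → ℝ) (hD : IsLocalPseudoDensity (uniformWeight (Fin n) Bool) d D) :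
    SAPseudoexpectation n d where
  E :=
    { toFun := fun g => muExpect (uniformWeight (Fin n) Bool) (fun x => D x * g x)
      map_add' := fun g h => by
        simp only [muExpect, Pi.add_apply, mul_add, sum_add_distrib]
      map_smul' := fun a g => by
        simp only [muExpect, Pi.smul_apply, smul_eq_mul, RingHom.id_apply, mul_sum]
        refine sum_congr rfl fun x _ => ?_
        ring }
  nonneg g hg hg0 := hD.2 g ((isKJunta_iff_isJunta g).2 hg) hg0
  map_one := by
    show muExpect (uniformWeight (Fin n) Bool) (fun x => D x * 1) = 1
    simp only [mul_one]
    exact hD.1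

/-- Unfolding `ofDensity`. [cite: KothariMekaRaghavendra2017, Def. 3.3 (p. 9)] -/
@[simp] theorem ofDensity_E (D : (Fin n → Bool) → ℝ)
    (hD : IsLocalPseudoDensity (uniformWeight (Fin n) Bool) d D) (g : (Fin n → Bool) → ℝ) :
    (ofDensity D hD).E g = muExpect (uniformWeight (Fin n) Bool) (fun x => D x * g x) := rfl

end SAPseudoexpectation

/-- **Sherali–Adams gaps transfer between the currencies**: a `d`-local pseudo-density of value `> c` on a
sound instance refutes `SAAchieves` (KMR currency). [cite: KothariMekaRaghavendra2017, Def. 3.3 and eq. (3.1) (p. 9)]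
[cite: LeeRaghavendraSteurer2015, §7.1 (arXiv p. 27)] -/
theorem not_saAchieves_of_pseudoDensity {k : ℕ} {P : Set ((Fin k → Bool) → Bool)} {c s : ℝ}
    (I : CSPInstance k n P) (hI : I.OptLE s) {D : (Fin n → Bool) → ℝ}
    (hD : IsLocalPseudoDensity (uniformWeight (Fin n) Bool) d D)
    (hval : c < muExpect (uniformWeight (Fin n) Bool) (fun x => D x * I.val x)) :
    ¬ SAAchieves (n := n) P d c s := by
  intro h
  have := h I hI (SAPseudoexpectation.ofDensity D hD)
  rw [SAPseudoexpectation.ofDensity_E] at this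
  linarith

namespace LocalExpectations

/-- **The binary consistent families are the `X = Bool` case of the general-alphabet ones** (same data:
local expectation functionals, positivity, normalisation, consistency under restriction).
[cite: CharikarMakarychevMakarychev2009, Lemma 2.1 (p. 4–5)] -/
def toOn (ℒ : LocalExpectations n d) : LocalExpectationsOn (Fin n) Bool d where
  L := ℒ.L
  nonneg := ℒ.nonneg
  map_one := ℒ.map_one
  consistent := ℒ.consistent

/-- `toOn` keeps the local functionals. [cite: CharikarMakarychevMakarychev2009, Lemma 2.1 (p. 4–5)] -/
@[simp] theorem toOn_L (ℒ : LocalExpectations n d) (T : Finset (Fin n)) : ℒ.toOn.L T = ℒ.L T := rfl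

/-- Hence a binary consistent family also yields a `d`-local pseudo-density in the Lee–Raghavendra–Steurer
currency reproducing its local expectations (via the general-alphabet construction).
[cite: CharikarMakarychevMakarychev2009, Lemma 2.1 (p. 4–5)] [cite: LeeRaghavendraSteurer2015, §7.1 (arXiv p. 27)] -/
theorem exists_pseudoDensity (ℒ : LocalExpectations n d) :
    ∃ D : (Fin n → Bool) → ℝ, IsLocalPseudoDensity (uniformWeight (Fin n) Bool) d D ∧
      ∀ (T : Finset (Fin n)), T.card ≤ d → ∀ g : (Fin n → Bool) → ℝ, IsSJunta T g →
        muExpect (uniformWeight (Fin n) Bool) (fun x => D x * g x) =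
          ℒ.L T (fun b => g (extendWith false T b)) :=
  ⟨ℒ.toOn.density false, ℒ.toOn.isLocalPseudoDensity_density false,
    fun _ hT _ hg => ℒ.toOn.muExpect_density_mul_of_isSJunta false hT hg⟩

end LocalExpectations

end Literature.Combinatorics.Optimization
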